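import Literature.AlgebraicGeometry.Frobenioids.BiratDivIdentityTransport
import Literature.AlgebraicGeometry.Frobenioids.Thm42DivIdentityWeak
import HarnessLib

/-!
# Frobenioids I, Cor. 4.11 (ii), p. 93 ll. 42–46 — `Ψ^birat` preserves endomorphisms projecting to `Φ`-identity
# endomorphisms of the base — for WEAKLY perf-factorial divisor monoids

Mochizuki, *The geometry of Frobenioids I: the general theory*, Kyushu J. Math. **62** (2008) 293–400, proof of
Cor. 4.11 (ii), kurims text p. 93 ll. 42–46 [cite: MochizukiFrdI2008, Cor. 4.11 (ii) p.93]: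

> "Since, by Theorem 4.2, (ii) [cf. also the fact that the `Φ_i` are perf-factorial and non-dilating], it follows
> immediately from the definition of `C_i^birat` that `Ψ^birat` preserves those endomorphisms [of an object of
> `C_i^birat`] that project to an automorphism of `D_i` that is mapped by `Φ_i` to an identity automorphism, we thus
> conclude that `Ψ^birat` preserves the base-identity endomorphisms".

PROOF-ONLY file (cell abc-iut, layer L1, node `FrdI:Cor4.11(ii)`; seat abc-iut-L1-t12, row «C411ii-WEAK» = the
[FrdI] Cor. 4.11 (ii) chain over `IsPerfFactorialWeak`, file (A)).  The WEAK-HYPOTHESIS TWIN of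
`BiratDivIdentityTransport.lean` (seat abc-iut-L1-d6): the same three theorems with the divisor-monoid hypothesis
"`Φ_i` perf-factorial" (Def. 2.4 (i) (a)–(d), `IsPerfFactorial`) WEAKENED to "`Φ_i` weakly perf-factorial" (Def. 2.4 (i)
(a)(b)(c) + (d_ord) + (d_res), `IsPerfFactorialWeak`, seat abc-iut-L1-t2's `PerfFactorialWeak.lean`; needed where (d)
fails, e.g. the divisor monoids `Φ₀(Y^log) ⊇ ∏_J ℤ_{≥0}` of [EtTh] §3 at coverings with infinitely many special-fibre
components, cell finding F-L2d2-1).  In the printed proof the perf-factorial hypothesis enters this step ONLY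
through THE bijections `Ψ^Prime` of Thm. 4.2 (ii) and their functoriality along base-isomorphisms — both available
over `IsPerfFactorialWeak` (`PreFrobenioid.existsUnique_primesEquiv_weak`, `PrimesEquivWeak.lean`;
`PreFrobenioid.primesEquiv_naturality_baseIso_mem_weak`, `Thm42DivIdentityWeak.lean`; this seat's lineage, row
«Thm. 4.2 chain over `IsPerfFactorialWeak`») — so the port is verbatim:
* `PreFrobenioid.pull_inv_base_comp_base_map_eq_id_weak` — the `C`-level statement: for a co-angular pre-step
  `α : A′ → A` and any `φ′ : A′ → A` with `Base(φ′) ∘ Base(α)⁻¹` pulling back to the identity of `Φ₁(A_D)`,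
  `Base(Ψφ′) ∘ Base(Ψα)⁻¹` pulls back to the identity of `Φ₂((ΨA)_D)` (non-dilation criterion
  `pull_eq_id_of_exists_precsim`, the lower square of Prop. 1.11 (v), `Ψ^Prime`);
* `PreFrobenioid.Birat.pull_base_mapOfEquiv_map_eq_id_weak` / `…_eq_id'_weak` — read on `C^birat` through the
  square of Cor. 4.10 (`mapOfEquivFac`): literally the hypothesis `h42` of
  `PreFrobenioid.Birat.mapIso_mem_unitsSubgroup_of_over` and `hdi` of `PreFrobenioid.isBaseIdentity_map_of_isDivSlim`
  for `Ψ^birat = mapOfEquiv Ψ`, now over weakly perf-factorial `Φ_i`.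
The printed case (Def. 2.4 (i) (a)–(d)) is the strong file itself, equivalently these theorems at
`fun X => (hpf_i X).weak` (`IsPerfFactorial.weak`).  Composition is diagrammatic; monoids multiplicative.  No new
definitions; no landed declaration touched; a named hypothesis is WEAKENED, nothing of the paper restated or
strengthened; nothing here is specific to the abc programme.  HONEST FRAMING: classical [FrdI] §4 category/monoid
algebra; nothing here bears on [IUTchIII] Cor. 3.12.
-/

namespace Literature.AlgebraicGeometry.Frobenioids

open CategoryTheory Opposite

namespace PreFrobenioid

universe w v v' u u'

section Two

variable {D₁ : Type u} [Category.{v} D₁] {Φ₁ : D₁ᵒᵖ ⥤ CommMonCat.{w}}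
  {C₁ : Type u'} [Category.{v'} C₁] {F₁ : C₁ ⥤ ElemFrobenioid Φ₁}
  {D₂ : Type u} [Category.{v} D₂] {Φ₂ : D₂ᵒᵖ ⥤ CommMonCat.{w}}
  {C₂ : Type u'} [Category.{v'} C₂] {F₂ : C₂ ⥤ ElemFrobenioid Φ₂}

set_option backward.isDefEq.respectTransparency false in
/-- **[FrdI] Cor. 4.11 (ii), p. 93 ll. 42–46, at the level of `C`, for WEAKLY perf-factorial `Φ_i`**: in the
setting of the proof of Thm. 4.2 after its reductions (Frobenioids of perfect and isotropic type, `Ψ` and `Ψ⁻¹` with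
the conclusions of Thm. 3.4 (ii)(iii) and Thm. 4.2 (i) — pre-steps, Frobenius type, pull-backs, primary pre-steps)
with `Φ_i` weakly perf-factorial and `Φ₂` non-dilating: for a co-angular pre-step `α : A′ → A` and any `φ′ : A′ → A`,
if `Base(φ′) ∘ Base(α)⁻¹` pulls back to the identity of `Φ₁(A_D)`, then `Base(Ψφ′) ∘ Base(Ψα)⁻¹` pulls back to the
identity of `Φ₂((ΨA)_D)` — by the bijections `Ψ^Prime` of Thm. 4.2 (ii) (`existsUnique_primesEquiv_weak`) and their
functoriality along the base-isomorphisms `α` and (the base-isomorphism part of) `φ′`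
(`primesEquiv_naturality_baseIso_mem_weak`), the square of Prop. 1.11 (v) for the pull-back part of `φ′`, and the
non-dilation criterion.  Weak twin of `pull_inv_base_comp_base_map_eq_id`. [cite: MochizukiFrdI2008, Cor. 4.11 (ii) p.93] -/
theorem pull_inv_base_comp_base_map_eq_id_weak (hF₁ : IsFrobenioid F₁) (hF₂ : IsFrobenioid F₂) (Ψ : C₁ ≌ C₂)
    (hperf₁ : IsOfPerfectType F₁) (hperf₂ : IsOfPerfectType F₂)
    (hiso₁ : IsOfIsotropicType F₁) (hiso₂ : IsOfIsotropicType F₂)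
    (hpf₁ : Objectwise (fun M _ => IsPerfFactorialWeak M) Φ₁)
    (hpf₂ : Objectwise (fun M _ => IsPerfFactorialWeak M) Φ₂)
    (hnd₂ : IsNonDilatingOn Φ₂)
    (hpre : ∀ ⦃X Y : C₁⦄ (φ : X ⟶ Y), IsPreStep F₁ φ → IsPreStep F₂ (Ψ.functor.map φ))
    (hpre' : ∀ ⦃X Y : C₂⦄ (φ : X ⟶ Y), IsPreStep F₂ φ → IsPreStep F₁ (Ψ.inverse.map φ))
    (hfrob : ∀ ⦃X Y : C₁⦄ (φ : X ⟶ Y), IsFrobeniusType F₁ φ → IsFrobeniusType F₂ (Ψ.functor.map φ))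
    (hpb : ∀ ⦃X Y : C₁⦄ (φ : X ⟶ Y), IsPullbackMorphism F₁ φ → IsPullbackMorphism F₂ (Ψ.functor.map φ))
    (hprim : ∀ ⦃X Y : C₁⦄ (φ : X ⟶ Y), IsPrimaryPreStep F₁ φ → IsPrimaryPreStep F₂ (Ψ.functor.map φ))
    (hprim' : ∀ ⦃X Y : C₂⦄ (φ : X ⟶ Y), IsPrimaryPreStep F₂ φ → IsPrimaryPreStep F₁ (Ψ.inverse.map φ))
    {A' A : C₁} (α φ' : A' ⟶ A) (hα : IsCoAngularPreStep F₁ α)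
    [IsIso (Base F₁ α)] [IsIso (Base F₂ (Ψ.functor.map α))]
    (h : pull Φ₁ (inv (Base F₁ α) ≫ Base F₁ φ') = MonoidHom.id _) :
    pull Φ₂ (inv (Base F₂ (Ψ.functor.map α)) ≫ Base F₂ (Ψ.functor.map φ')) = MonoidHom.id _ := by
  classical
  have hP₂ := hF₂.isPreFrobenioid
  -- `Base(φ′)^* = Base(α)^*` on `Φ₁(A_D)`
  have hφ' : ∀ x, pull Φ₁ (Base F₁ φ') x = pull Φ₁ (Base F₁ α) x := by
    intro x
    have hx := DFunLike.congr_fun h x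
    rw [MonoidHom.id_apply, pull_comp] at hx
    have hx' := congrArg (pull Φ₁ (Base F₁ α)) hx
    rwa [← pull_comp, IsIso.hom_inv_id, pull_id] at hx'
  -- the family `e = Ψ^Prime` of Thm. 4.2 (ii) with its defining property (one object at a time)
  have H := fun X : C₁ => existsUnique_primesEquiv_weak Ψ hF₁ hF₂ hiso₁ hiso₂ hpf₁ hpf₂ hpre hpre' X
    (fun E ε hε => hprim ε hε) (fun Z ξ hξ => hprim' ξ hξ)
  choose e he using fun X => (H X).exists
  have he' : ∀ (X : C₁) ⦃E : C₁⦄ (ε : E ⟶ X) (hε : IsPrimaryPreStep F₁ ε)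
      (𝔭 : Primes (Φ₁.obj (op (baseObj F₁ X)))), invDiv F₁ ε hε.1.2 ∈ 𝔭.carrier →
        ∀ h₂ : IsBaseIso F₂ (Ψ.functor.map ε), invDiv F₂ (Ψ.functor.map ε) h₂ ∈ (e X 𝔭).carrier :=
    fun X E ε hε 𝔭 h _ => he X ε hε 𝔭 h
  -- Def. 1.3 (iv)(a): `φ′ = γ_F ≫ β_p ≫ δ`; `γ := γ_F ≫ β_p` is a base-isomorphism, `δ` a pull-back morphism
  obtain ⟨X, B, γF, βp, δ, hfac, hγF, hβp, hδ⟩ := hF₁.iv_a_exists φ'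
  have hγbase : IsBaseIso F₁ (γF ≫ βp) := by
    haveI : IsIso (Base F₁ γF) := hγF.2
    haveI : IsIso (Base F₁ βp) := hβp.2
    change IsIso (Base F₁ (γF ≫ βp))
    rw [base_comp]
    infer_instance
  have hfac' : (γF ≫ βp) ≫ δ = φ' := by rw [Category.assoc]; exact hfac
  -- the criterion: one element per prime of `Φ₂((ΨA)_D)`
  refine pull_eq_id_of_exists_precsim hP₂ hnd₂ _ fun 𝔮 => ?_
  -- `𝔮 = e_A 𝔭`; a co-angular (primary) pre-step `ε″ : A″ → A` with `x_{ε″} ∈ 𝔭`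
  obtain ⟨⟨p, hp⟩, hp𝔭⟩ := Quotient.exists_rep ((e A).symm 𝔮)
  have hpmem : p ∈ ((e A).symm 𝔮).carrier := by rw [← hp𝔭]; exact mem_carrier_mk_of_isPrimary hp
  obtain ⟨A'', ε'', hε'', hε''x⟩ := hF₁.iii_d_over_surj A p
  have hε''prim : IsPrimaryPreStep F₁ ε'' :=
    isPrimaryPreStep_of_isPrimary_invDiv hε''.2 (by rw [hε''x]; exact hp)
  have hε''mem : invDiv F₁ ε'' hε''.2.2 ∈ ((e A).symm 𝔮).carrier := by rw [hε''x]; exact hpmem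
  -- the lower square `ε_B ≫ δ = δ′ ≫ ε″` (Prop. 1.11 (v)) and its divisor calculus
  obtain ⟨W, εB, δ', hεB, hδ', hsq⟩ := exists_preStep_pullback_square hF₁ hiso₁ δ hδ ε'' hε''
  have hxB : invDiv F₁ εB hεB.2.2 = pull Φ₁ (Base F₁ δ) (invDiv F₁ ε'' hε''.2.2) :=
    invDiv_eq_pull_of_pullback_square hF₁ hεB.2 hδ hδ' hε''.2 hsq
  -- `Φ(Base γ)(x_{ε_B}) = Φ(Base φ′)(x_{ε″}) = Φ(Base α)(x_{ε″})`
  have hγxB : pull Φ₁ (Base F₁ (γF ≫ βp)) (invDiv F₁ εB hεB.2.2) =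
      pull Φ₁ (Base F₁ α) (invDiv F₁ ε'' hε''.2.2) := by
    rw [hxB, ← pull_comp, ← base_comp, hfac', hφ']
  -- the prime `𝔭′ ⊆ Φ₁(A′_D)` of `Φ(Base α)(x_{ε″})`, and the prime `𝔭_B ⊆ Φ₁(B_D)` of `x_{ε_B}`
  have hαp_prim : IsPrimary (pull Φ₁ (Base F₁ α) (invDiv F₁ ε'' hε''.2.2)) :=
    (isPrimary_pull_iff (Base F₁ α) _).mpr (isPrimary_invDiv hε''prim)
  let 𝔭' : Primes (Φ₁.obj (op (baseObj F₁ A'))) := Quotient.mk _ ⟨_, hαp_prim⟩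
  have hαp_mem : pull Φ₁ (Base F₁ α) (invDiv F₁ ε'' hε''.2.2) ∈ 𝔭'.carrier :=
    mem_carrier_mk_of_isPrimary hαp_prim
  have hxBprim : IsPrimary (invDiv F₁ εB hεB.2.2) := by
    haveI : IsIso (Base F₁ (γF ≫ βp)) := hγbase
    have h' := hαp_prim
    rw [← hγxB] at h'
    exact (isPrimary_pull_iff (Base F₁ (γF ≫ βp)) _).mp h'
  have hεBprim : IsPrimaryPreStep F₁ εB := isPrimaryPreStep_of_isPrimary_invDiv hεB.2 hxBprim
  let 𝔭B : Primes (Φ₁.obj (op (baseObj F₁ B))) := Quotient.mk _ ⟨_, hxBprim⟩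
  have hxBmem : invDiv F₁ εB hεB.2.2 ∈ 𝔭B.carrier := mem_carrier_mk_of_isPrimary hxBprim
  -- functoriality of `Ψ^Prime` along the base-isomorphisms `γ : A′ → B` and `α : A′ → A`
  obtain ⟨q', hq', hq'pull⟩ := primesEquiv_naturality_baseIso_mem_weak Ψ hF₁ hF₂ hperf₁ hperf₂ hiso₁ hiso₂
    hpf₁ hpf₂ hpre hpre' hfrob hprim e he' (γF ≫ βp) hγbase 𝔭' 𝔭B
    ⟨invDiv F₁ εB hεB.2.2, hxBmem, by rw [hγxB]; exact hαp_mem⟩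
  obtain ⟨q'', hq'', hq''pull⟩ := primesEquiv_naturality_baseIso_mem_weak Ψ hF₁ hF₂ hperf₁ hperf₂ hiso₁ hiso₂
    hpf₁ hpf₂ hpre hpre' hfrob hprim e he' α hα.2.2 𝔭' ((e A).symm 𝔮)
    ⟨invDiv F₁ ε'' hε''.2.2, hε''mem, hαp_mem⟩
  rw [Equiv.apply_symm_apply] at hq''
  -- the square transported by `Ψ` and its divisor calculus in `C₂`
  have hΨεB : IsPreStep F₂ (Ψ.functor.map εB) := hpre εB hεB.2
  have hΨε'' : IsPreStep F₂ (Ψ.functor.map ε'') := hpre ε'' hε''.2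
  have hΨsq : Ψ.functor.map εB ≫ Ψ.functor.map δ = Ψ.functor.map δ' ≫ Ψ.functor.map ε'' := by
    rw [← Functor.map_comp, hsq, Functor.map_comp]
  have hxB₂ : invDiv F₂ (Ψ.functor.map εB) hΨεB.2 =
      pull Φ₂ (Base F₂ (Ψ.functor.map δ)) (invDiv F₂ (Ψ.functor.map ε'') hΨε''.2) :=
    invDiv_eq_pull_of_pullback_square hF₂ hΨεB (hpb δ hδ) (hpb δ' hδ') hΨε'' hΨsq
  -- memberships given by `e`
  have hq : invDiv F₂ (Ψ.functor.map ε'') hΨε''.2 ∈ 𝔮.carrier := by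
    have h' := he A ε'' hε''prim ((e A).symm 𝔮) hε''mem
    rwa [Equiv.apply_symm_apply] at h'
  have hqB : invDiv F₂ (Ψ.functor.map εB) hΨεB.2 ∈ (e B 𝔭B).carrier := he B εB hεBprim 𝔭B hxBmem
  -- conclusion: `Base(Ψα)^{-1} Base(Ψφ′) (x_{Ψε″}) = Base(Ψα)^{-1} Base(Ψγ) (x_{Ψε_B}) ≼ … ≼ x_{Ψε″}`
  refine ⟨invDiv F₂ (Ψ.functor.map ε'') hΨε''.2, hq, ?_⟩
  have hcalc : pull Φ₂ (inv (Base F₂ (Ψ.functor.map α)))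
        (pull Φ₂ (Base F₂ (Ψ.functor.map (γF ≫ βp))) (invDiv F₂ (Ψ.functor.map εB) hΨεB.2)) =
      pull Φ₂ (inv (Base F₂ (Ψ.functor.map α)) ≫ Base F₂ (Ψ.functor.map φ'))
        (invDiv F₂ (Ψ.functor.map ε'') hΨε''.2) := by
    rw [hxB₂, ← pull_comp Φ₂ (Base F₂ (Ψ.functor.map (γF ≫ βp))) (Base F₂ (Ψ.functor.map δ)),
      ← base_comp, ← Functor.map_comp, hfac', pull_comp]
  rw [← hcalc]
  have T1 : pull Φ₂ (Base F₂ (Ψ.functor.map (γF ≫ βp))) (invDiv F₂ (Ψ.functor.map εB) hΨεB.2) ≼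
      pull Φ₂ (Base F₂ (Ψ.functor.map α)) q'' :=
    (((Primes.precsim_of_mem_carrier _ hqB hq').map _).trans
      (Primes.precsim_of_mem_carrier _ hq'pull hq''pull))
  have T2 := T1.map (pull Φ₂ (inv (Base F₂ (Ψ.functor.map α))))
  rw [← pull_comp Φ₂ (inv (Base F₂ (Ψ.functor.map α))) (Base F₂ (Ψ.functor.map α)), IsIso.inv_hom_id,
    pull_id] at T2
  exact T2.trans (Primes.precsim_of_mem_carrier _ hq'' hq)

/-! ### Read on `C^birat`: the hypothesis `h42` of `Birat.mapIso_mem_unitsSubgroup_of_over` -/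

set_option backward.isDefEq.respectTransparency false in
/-- **[FrdI] Cor. 4.11 (ii), p. 93 ll. 42–46, for WEAKLY perf-factorial `Φ_i`: `Ψ^birat` carries endomorphisms of
`C₁^birat` projecting to `Φ₁`-identity endomorphisms to endomorphisms of `C₂^birat` projecting to `Φ₂`-identity
endomorphisms** — in the setting of the proof of Thm. 4.2 after its reductions (perfect + isotropic type, the
conclusions of Thm. 3.4 (ii)(iii) and Thm. 4.2 (i) for `Ψ`, `Ψ⁻¹`) with `Φ_i` weakly perf-factorial and `Φ₂`
non-dilating.  This is literally the hypothesis `h42` of `PreFrobenioid.Birat.mapIso_mem_unitsSubgroup_of_over` for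
`Ψ^birat = mapOfEquiv Ψ` (Cor. 4.10): an endomorphism of `A^birat` is a fraction `α⁻¹ ∘ φ′`, `Ψ^birat` maps it — by
the square of Cor. 4.10 — to a conjugate of `(Ψα)⁻¹ ∘ Ψφ′`, and `pull_inv_base_comp_base_map_eq_id_weak` applies.
Weak twin of `Birat.pull_base_mapOfEquiv_map_eq_id`. [cite: MochizukiFrdI2008, Cor. 4.11 (ii) p.93] -/
theorem Birat.pull_base_mapOfEquiv_map_eq_id_weak (hF₁ : IsFrobenioid F₁) (hsq₁ : HasBiratSquares F₁)
    (hF₂ : IsFrobenioid F₂) (hsq₂ : HasBiratSquares F₂) (Ψ : C₁ ≌ C₂)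
    (hΨ : ∀ ⦃A B : C₁⦄ (f : A ⟶ B), IsCoAngularPreStep F₁ f → IsCoAngularPreStep F₂ (Ψ.functor.map f))
    (hperf₁ : IsOfPerfectType F₁) (hperf₂ : IsOfPerfectType F₂)
    (hiso₁ : IsOfIsotropicType F₁) (hiso₂ : IsOfIsotropicType F₂)
    (hpf₁ : Objectwise (fun M _ => IsPerfFactorialWeak M) Φ₁)
    (hpf₂ : Objectwise (fun M _ => IsPerfFactorialWeak M) Φ₂)
    (hnd₂ : IsNonDilatingOn Φ₂)
    (hpre : ∀ ⦃X Y : C₁⦄ (φ : X ⟶ Y), IsPreStep F₁ φ → IsPreStep F₂ (Ψ.functor.map φ))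
    (hpre' : ∀ ⦃X Y : C₂⦄ (φ : X ⟶ Y), IsPreStep F₂ φ → IsPreStep F₁ (Ψ.inverse.map φ))
    (hfrob : ∀ ⦃X Y : C₁⦄ (φ : X ⟶ Y), IsFrobeniusType F₁ φ → IsFrobeniusType F₂ (Ψ.functor.map φ))
    (hpb : ∀ ⦃X Y : C₁⦄ (φ : X ⟶ Y), IsPullbackMorphism F₁ φ → IsPullbackMorphism F₂ (Ψ.functor.map φ))
    (hprim : ∀ ⦃X Y : C₁⦄ (φ : X ⟶ Y), IsPrimaryPreStep F₁ φ → IsPrimaryPreStep F₂ (Ψ.functor.map φ))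
    (hprim' : ∀ ⦃X Y : C₂⦄ (φ : X ⟶ Y), IsPrimaryPreStep F₂ φ → IsPrimaryPreStep F₁ (Ψ.inverse.map φ))
    {A : C₁} (φ : (toBirat F₁ hF₁ hsq₁).obj A ⟶ (toBirat F₁ hF₁ hsq₁).obj A)
    (hφ : pull Φ₁ (Base (Birat.toElemZero hF₁ hsq₁) φ) = MonoidHom.id _) :
    pull Φ₂ (Base (Birat.toElemZero hF₂ hsq₂) ((mapOfEquiv hF₁ hsq₁ hF₂ hsq₂ Ψ hΨ).map φ)) =
      MonoidHom.id _ := by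
  obtain ⟨f, rfl⟩ := exists_homMk_eq φ
  haveI : IsIso (Base F₁ f.den) := f.den_mem.2.2
  haveI : IsIso (Base F₂ (Ψ.functor.map f.den)) := (hpre f.den f.den_mem.2).2
  -- the fraction: `Base([(α, φ′)]) = Base(α)⁻¹ ≫ Base(φ′)`, so the hypothesis reads on `(α, φ′)`
  have key : (toBirat F₁ hF₁ hsq₁).map f.den ≫
      (homMk f : (toBirat F₁ hF₁ hsq₁).obj A ⟶ (toBirat F₁ hF₁ hsq₁).obj A) = (toBirat F₁ hF₁ hsq₁).map f.num :=
    toBirat_map_den_comp_homMk hF₁ hsq₁ f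
  have hb : Base (Birat.toElemZero hF₁ hsq₁)
      (homMk f : (toBirat F₁ hF₁ hsq₁).obj A ⟶ (toBirat F₁ hF₁ hsq₁).obj A) =
        inv (Base F₁ f.den) ≫ Base F₁ f.num := by
    rw [IsIso.eq_inv_comp, ← base_toElemZero_map (hF := hF₁) (hsq := hsq₁) f.den, ← base_comp, key,
      base_toElemZero_map]
  have hf : pull Φ₁ (inv (Base F₁ f.den) ≫ Base F₁ f.num) = MonoidHom.id _ := by rw [← hb]; exact hφ
  -- the square of Cor. 4.10: `Ψ^birat([(α, φ′)])` is the conjugate by `e_A` of `χ` with `(Ψα)^birat ≫ χ = (Ψφ′)^birat`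
  let e := mapOfEquivFac hF₁ hsq₁ hF₂ hsq₂ Ψ hΨ
  have keyM : (toBirat F₁ hF₁ hsq₁ ⋙ mapOfEquiv hF₁ hsq₁ hF₂ hsq₂ Ψ hΨ).map f.den ≫
      (mapOfEquiv hF₁ hsq₁ hF₂ hsq₂ Ψ hΨ).map
        (homMk f : (toBirat F₁ hF₁ hsq₁).obj A ⟶ (toBirat F₁ hF₁ hsq₁).obj A) =
        (toBirat F₁ hF₁ hsq₁ ⋙ mapOfEquiv hF₁ hsq₁ hF₂ hsq₂ Ψ hΨ).map f.num := by
    have h' := congrArg (mapOfEquiv hF₁ hsq₁ hF₂ hsq₂ Ψ hΨ).map key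
    rw [Functor.map_comp] at h'
    exact h'
  have nden := e.hom.naturality f.den
  have nnum := e.hom.naturality f.num
  let χ : (Ψ.functor ⋙ toBirat F₂ hF₂ hsq₂).obj A ⟶ (Ψ.functor ⋙ toBirat F₂ hF₂ hsq₂).obj A :=
    e.inv.app A ≫ (mapOfEquiv hF₁ hsq₁ hF₂ hsq₂ Ψ hΨ).map
      (homMk f : (toBirat F₁ hF₁ hsq₁).obj A ⟶ (toBirat F₁ hF₁ hsq₁).obj A) ≫ e.hom.app A
  have hχ : (Ψ.functor ⋙ toBirat F₂ hF₂ hsq₂).map f.den ≫ χ = (Ψ.functor ⋙ toBirat F₂ hF₂ hsq₂).map f.num := by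
    haveI : IsIso (e.hom.app f.src) := ⟨⟨e.inv.app f.src, e.hom_inv_id_app f.src, e.inv_hom_id_app f.src⟩⟩
    rw [← cancel_epi (e.hom.app f.src)]
    change e.hom.app f.src ≫ (Ψ.functor ⋙ toBirat F₂ hF₂ hsq₂).map f.den ≫ e.inv.app A ≫
      (mapOfEquiv hF₁ hsq₁ hF₂ hsq₂ Ψ hΨ).map
        (homMk f : (toBirat F₁ hF₁ hsq₁).obj A ⟶ (toBirat F₁ hF₁ hsq₁).obj A) ≫ e.hom.app A =
        e.hom.app f.src ≫ (Ψ.functor ⋙ toBirat F₂ hF₂ hsq₂).map f.num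
    rw [← Category.assoc, ← nden, Category.assoc, e.hom_inv_id_app_assoc, ← Category.assoc, keyM, nnum]
  have hχbase : Base (Birat.toElemZero hF₂ hsq₂) χ =
      inv (Base F₂ (Ψ.functor.map f.den)) ≫ Base F₂ (Ψ.functor.map f.num) := by
    rw [IsIso.eq_inv_comp, ← base_toElemZero_map (hF := hF₂) (hsq := hsq₂) (Ψ.functor.map f.den),
      ← base_comp]
    have hχ' : (toBirat F₂ hF₂ hsq₂).map (Ψ.functor.map f.den) ≫ χ =
        (toBirat F₂ hF₂ hsq₂).map (Ψ.functor.map f.num) := hχ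
    rw [hχ', base_toElemZero_map]
  have hMχ : (mapOfEquiv hF₁ hsq₁ hF₂ hsq₂ Ψ hΨ).map
      (homMk f : (toBirat F₁ hF₁ hsq₁).obj A ⟶ (toBirat F₁ hF₁ hsq₁).obj A) =
        (e.app A).symm.inv ≫ χ ≫ (e.app A).symm.hom := by
    change _ = e.hom.app A ≫ (e.inv.app A ≫ _ ≫ e.hom.app A) ≫ e.inv.app A
    simp only [Category.assoc]
    rw [e.hom_inv_id_app_assoc, e.hom_inv_id_app]
    exact (Category.comp_id _).symm
  -- the `C`-level statement, conjugated by `e_A`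
  have hcore : pull Φ₂ (Base (Birat.toElemZero hF₂ hsq₂) χ) = MonoidHom.id _ := by
    rw [hχbase]
    exact pull_inv_base_comp_base_map_eq_id_weak hF₁ hF₂ Ψ hperf₁ hperf₂ hiso₁ hiso₂ hpf₁ hpf₂ hnd₂ hpre hpre'
      hfrob hpb hprim hprim' f.den f.num f.den_mem hf
  rw [hMχ]
  exact pull_base_conj_iso hcore (e.app A).symm

/-- The same for an endomorphism of an arbitrary object `X` of `C₁^birat` (every object is `A^birat`), `Φ_i` weakly
perf-factorial.  Weak twin of `Birat.pull_base_mapOfEquiv_map_eq_id'`. [cite: MochizukiFrdI2008, Cor. 4.11 (ii) p.93] -/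
theorem Birat.pull_base_mapOfEquiv_map_eq_id'_weak (hF₁ : IsFrobenioid F₁) (hsq₁ : HasBiratSquares F₁)
    (hF₂ : IsFrobenioid F₂) (hsq₂ : HasBiratSquares F₂) (Ψ : C₁ ≌ C₂)
    (hΨ : ∀ ⦃A B : C₁⦄ (f : A ⟶ B), IsCoAngularPreStep F₁ f → IsCoAngularPreStep F₂ (Ψ.functor.map f))
    (hperf₁ : IsOfPerfectType F₁) (hperf₂ : IsOfPerfectType F₂)
    (hiso₁ : IsOfIsotropicType F₁) (hiso₂ : IsOfIsotropicType F₂)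
    (hpf₁ : Objectwise (fun M _ => IsPerfFactorialWeak M) Φ₁)
    (hpf₂ : Objectwise (fun M _ => IsPerfFactorialWeak M) Φ₂)
    (hnd₂ : IsNonDilatingOn Φ₂)
    (hpre : ∀ ⦃X Y : C₁⦄ (φ : X ⟶ Y), IsPreStep F₁ φ → IsPreStep F₂ (Ψ.functor.map φ))
    (hpre' : ∀ ⦃X Y : C₂⦄ (φ : X ⟶ Y), IsPreStep F₂ φ → IsPreStep F₁ (Ψ.inverse.map φ))
    (hfrob : ∀ ⦃X Y : C₁⦄ (φ : X ⟶ Y), IsFrobeniusType F₁ φ → IsFrobeniusType F₂ (Ψ.functor.map φ))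
    (hpb : ∀ ⦃X Y : C₁⦄ (φ : X ⟶ Y), IsPullbackMorphism F₁ φ → IsPullbackMorphism F₂ (Ψ.functor.map φ))
    (hprim : ∀ ⦃X Y : C₁⦄ (φ : X ⟶ Y), IsPrimaryPreStep F₁ φ → IsPrimaryPreStep F₂ (Ψ.functor.map φ))
    (hprim' : ∀ ⦃X Y : C₂⦄ (φ : X ⟶ Y), IsPrimaryPreStep F₂ φ → IsPrimaryPreStep F₁ (Ψ.inverse.map φ))
    (X : Birat F₁ hF₁ hsq₁) (φ : X ⟶ X)
    (hφ : pull Φ₁ (Base (Birat.toElemZero hF₁ hsq₁) φ) = MonoidHom.id _) :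
    pull Φ₂ (Base (Birat.toElemZero hF₂ hsq₂) ((mapOfEquiv hF₁ hsq₁ hF₂ hsq₂ Ψ hΨ).map φ)) =
      MonoidHom.id _ :=
  Birat.pull_base_mapOfEquiv_map_eq_id_weak hF₁ hsq₁ hF₂ hsq₂ Ψ hΨ hperf₁ hperf₂ hiso₁ hiso₂ hpf₁ hpf₂ hnd₂ hpre
    hpre' hfrob hpb hprim hprim' (A := X.out) φ hφ

/-- The printed case is recovered: at `fun X => (hpf_i X).weak` the weak theorem IS the strong one (definitional; a
record that the weakening is genuine and loses nothing). [cite: MochizukiFrdI2008, Cor. 4.11 (ii) p.93] -/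
example (hF₁ : IsFrobenioid F₁) (hsq₁ : HasBiratSquares F₁)
    (hF₂ : IsFrobenioid F₂) (hsq₂ : HasBiratSquares F₂) (Ψ : C₁ ≌ C₂)
    (hΨ : ∀ ⦃A B : C₁⦄ (f : A ⟶ B), IsCoAngularPreStep F₁ f → IsCoAngularPreStep F₂ (Ψ.functor.map f))
    (hperf₁ : IsOfPerfectType F₁) (hperf₂ : IsOfPerfectType F₂)
    (hiso₁ : IsOfIsotropicType F₁) (hiso₂ : IsOfIsotropicType F₂)
    (hpf₁ : Objectwise (fun M _ => IsPerfFactorial M) Φ₁) (hpf₂ : Objectwise (fun M _ => IsPerfFactorial M) Φ₂)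
    (hnd₂ : IsNonDilatingOn Φ₂)
    (hpre : ∀ ⦃X Y : C₁⦄ (φ : X ⟶ Y), IsPreStep F₁ φ → IsPreStep F₂ (Ψ.functor.map φ))
    (hpre' : ∀ ⦃X Y : C₂⦄ (φ : X ⟶ Y), IsPreStep F₂ φ → IsPreStep F₁ (Ψ.inverse.map φ))
    (hfrob : ∀ ⦃X Y : C₁⦄ (φ : X ⟶ Y), IsFrobeniusType F₁ φ → IsFrobeniusType F₂ (Ψ.functor.map φ))
    (hpb : ∀ ⦃X Y : C₁⦄ (φ : X ⟶ Y), IsPullbackMorphism F₁ φ → IsPullbackMorphism F₂ (Ψ.functor.map φ))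
    (hprim : ∀ ⦃X Y : C₁⦄ (φ : X ⟶ Y), IsPrimaryPreStep F₁ φ → IsPrimaryPreStep F₂ (Ψ.functor.map φ))
    (hprim' : ∀ ⦃X Y : C₂⦄ (φ : X ⟶ Y), IsPrimaryPreStep F₂ φ → IsPrimaryPreStep F₁ (Ψ.inverse.map φ))
    (X : Birat F₁ hF₁ hsq₁) (φ : X ⟶ X)
    (hφ : pull Φ₁ (Base (Birat.toElemZero hF₁ hsq₁) φ) = MonoidHom.id _) :
    pull Φ₂ (Base (Birat.toElemZero hF₂ hsq₂) ((Birat.mapOfEquiv hF₁ hsq₁ hF₂ hsq₂ Ψ hΨ).map φ)) =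
      MonoidHom.id _ :=
  Birat.pull_base_mapOfEquiv_map_eq_id'_weak hF₁ hsq₁ hF₂ hsq₂ Ψ hΨ hperf₁ hperf₂ hiso₁ hiso₂
    (fun X => (hpf₁ X).weak) (fun X => (hpf₂ X).weak) hnd₂ hpre hpre' hfrob hpb hprim hprim' X φ hφ

end Two

end PreFrobenioid

end Literature.AlgebraicGeometry.Frobenioids
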